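import Summits.QuantumFields.BalabanUV.Beta.GAN24.CombWilsonSector
import Summits.QuantumFields.BalabanUV.Beta.GAN24.SrecBornSector

/-!
# The (III′) born remainder `combBornOf` of the comb-chart S-tower, UNROLLED — every sym-table source pushed once through its own comb
# level and then through the CONJUGATED dressed leg chains; the closed form in the adopted units

NOT IN PRINT — OUR BOOKKEEPING (road-P2 = `b2b-balaban-gan24-p2` gen 56, 2026-08-25; row G-an2-4 ∕ (CONV-C), the (α-0) chain at row D1's literal
OF RECORD (III′) `JsB12CombShSym`; [our objects — bookkeeping, asserting nothing] THREE pointwise `def`s (`combFreshAt` — the sources; `combStepMap` ∕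
`combUnitStepMap` — the level maps, native and in units) + [folklore] composition BY NAME; 0 cite, 0 `def … : Prop`, 0 `sorry`).  Weight 0.
NEVER «G-an2-4 closed» as (CONV-C); NOT D1, NOT BetaPertH, NOT continuum, NOT Clay; NO campaign opened (an2 W-4).

This is the (III′) twin of leaf-03's (E-α-V) `GAN24/SrecBornSector` for M.50's remainder `CombWilsonSector.combBornOf` (`ScombOf = combWilsonAt + combBornOf`,
decoupled recursion `combBornOf_succ`).  Write `Ψ̂ = psiKS (ctrOff (d+1) Lc) Lc`, `𝒯 X κ u = Ψ̂ᵀ ∘ slotPsiS X κ u ∘ Ψ̂` (M.43), `ψ♭ α x κ u = Ψ̂ u x (inl κ) (inl α)` (M.47),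
`R_j = respStepBmSeq ρ_c Lc j` (`ρ_c = ctr (d+1) Lc`), `K̃_j = KStepUnit Lc j`, `c₃ = cE·Lc^{2(d+1)}`.
* §1 `combFreshAt tabs cVH cΛ j` — the SOURCES at the sym tables: member 0's border + Λ sectors (`cVH • tabs.V + cΛ • SLam … tabs.H`), member `j+1`'s fresh
  `(cVH·wVH (j+1)) • tabs.V + (cΛ·wΛ (j+1)) • SLam (lamCoeffK K_{j+1} E2_{j+1} Lc) tabs.H`; `combStepMap Lc cE j S := (cE·wE (j+1)) • e3OfK Lc (GcombSh Lc j) S`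
  (the level map of the (III′) recursion); `combUnitStepMap Lc cE j S := c₃ • e3K (coDressKBmAt ρ_c Lc K̃_j) Lc (𝒯 S)` = (E)'s `SrecBornSector.unitStepMap` at the root
  `ρ_c` READ ON THE TRANSPORTED TABLE (`combUnitStepMap_eq_unitStepMap_transport`, `rfl`); `combBornOf_zero_eq_combFreshAt`, `combBornOf_succ_eq` (M.50).
  Every level map lands in ff-valued tables (`isFF_combStepMap ∕ isFF_combUnitStepMap`, any table: `e3OfK ∕ e3K = −mmRead`).
* §2 THE CLASS `∃ Cs δ, 0 < δ ∧ LocStencil S Cs δ` ((E)'s `isLoc_zero ∕ _add ∕ _smul` BY NAME): preserved by `combStepMap` (an2's `locStencil_e3OfK` with `decays_GcombSh`),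
  on which `combStepMap` is ADDITIVE (leaf-01's `e3K_add`); every source is in the class; the class is preserved by `unitS` and by a three-leg push through localised legs.
* §3 **`combBornOf_eq_sum_transport`** — `combBornOf k = transport combStepMap 0 k (combFreshAt 0) + Σ_{m<k} transport combStepMap (m+1) (k−1−m) (combFreshAt (m+1))`
  (leaf-01's discrete Duhamel engine `AffineUnroll.eq_transport_add_sum`).
* §4 UNITS ON THE CLASS: **`unitS_combStepMap`** (`unitS_{j+1} ∘ combStepMap j = combUnitStepMap j ∘ unitS_j` on local tables: M.49 `unitS_combCubicStep_eq` + `unitS_transport`)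
  and **`unitS_transport_combStepMap`** (`unitS_{m+n} ∘ transport combStepMap m n = transport combUnitStepMap m n ∘ unitS_m` on the class).
* §5 for an ff-valued LOCAL table `X`: `combUnitStepMap j X = c₃ • push₃ (ψ♭∘R_j) (ψ♭∘R_j) (ψ♭∘R_j) X` (leaf-03's `e3K_coDressKBmAt_KStepUnit_of_isFF` on `𝒯 X` + M.47
  `push₃_transport_eq_push₃_legComp`); **`transport_combUnitStepMap_succ_eq_push₃`** — `transport combUnitStepMap m (n+1) X = c₃^{n+1} • push₃ T′ T′ T′ X`,
  `T′ = legChain (fun j ↦ legComp ψ♭ R_j) m n` (leaf-01's `Push3Nest.transport_push₃`; M.49 `legDecay_legComp_psiKS`); and, since the FIRST level map already lands in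
  ff-valued local tables, for ANY source `S` in the class **`transport_combUnitStepMap_succ_succ_eq_push₃`** — `transport combUnitStepMap i (n+2) S
  = c₃^{n+1} • push₃ T″ T″ T″ (combUnitStepMap i S)`, `T″ = legChain (fun j ↦ legComp ψ♭ R_j) (i+1) n`.
* §6 THE CLOSED FORM **`unitS_combBornOf_eq_sum`**: `unitS_k (combBornOf k) = transport combUnitStepMap 0 k (unitS_0 (combFreshAt 0)) + Σ_{m<k} transport combUnitStepMap
  (m+1) (k−1−m) (unitS_{m+1} (combFreshAt (m+1)))` — (E)'s `unitS_bornSecAt_eq_sum` token for token with `(freshAt ρ, stepMap ρ, unitStepMap ρ) ↦ (combFreshAt tabs,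
  combStepMap, combUnitStepMap)`: the (III′) born sectors differ from the (E) ones by the sym tables in the sources, ONE `𝒯` at each source's first level, and
  `R_j ↦ legComp ψ♭ R_j` in every later leg.
Discharges NO slot letter; asserts NO shape of Bałaban's stencils; 0 wall binders. -/

noncomputable section

open Finset
open scoped BigOperators
open Literature.MathematicalPhysics.QuantumFieldTheory
open Literature.MathematicalPhysics.QuantumFieldTheory.Balaban1983to89
open Literature.MathematicalPhysics.QuantumFieldTheory.Balaban1983to89.Beta
open ExpKernelCalculus (MKer Decays comp)
open AffineAveraging (Site box toSite)
open AveragingContoursRooted (ctr ctrOff ctrOff_mem_box)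
open OneStepResolventKernel (Fib LocStencil KInv)
open OneStepKernelFamily (KInvStep decays_KInvStep)
open BalabanStepJetsSucc (wE wVH wΛ E2 lamCoeffK)
open StepJetData (locStencil_smul)
open BalabanStepJets (lamCoeffOf locStencil_mono)
open InterLevelTransport (SLam)
open Summit.QuantumFields.BalabanUV.Beta.TameKernelCalculus (trK)
open Summit.QuantumFields.BalabanUV.Beta.HessKerDressedUnits (unitS locStencil_unitS decays_unitK)
open Summit.QuantumFields.BalabanUV.Beta.GAN24.CombesThomas (sfStep smStep KStepUnit)
open Summit.QuantumFields.BalabanUV.Beta.GAN24.ThirdJetKernel (e3K)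
open Summit.QuantumFields.BalabanUV.Beta.AxialDressingRooted (coDressKBmAt one_le_of_neZero decays_coDressKBmAt)
open Summit.QuantumFields.BalabanUV.Beta.SpineRooted (e3OfK e3OfK_apply locStencil_e3OfK)
open Summit.QuantumFields.BalabanUV.Beta.GAN24.CubicReadoutDecLift (e3OfK_eq_e3K)
open Summit.QuantumFields.BalabanUV.Beta.GAN24.StencilSlotOfShapes (unitS_add)
open Summit.QuantumFields.BalabanUV.Beta.GAN24.Push4 (legComp IsFF isFF_mmRead)
open Summit.QuantumFields.BalabanUV.Beta.GAN24.Push4Bounds (LegDecay)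
open Summit.QuantumFields.BalabanUV.Beta.GAN24.Push4Iter (LegFam legChain)
open Summit.QuantumFields.BalabanUV.Beta.GAN24.Push3 (push₃ push₃_smul isFF_push₃ locStencil_push₃_mono)
open Summit.QuantumFields.BalabanUV.Beta.GAN24.AffineUnroll (transport transport_zero transport_succ transport_succ' eq_transport_add_sum transport_mem)
open Summit.QuantumFields.BalabanUV.Beta.GAN24.Push3Nest (transport_push₃)
open Summit.QuantumFields.BalabanUV.Beta.GAN24.SrecLinearPartEq (e3K_add)
open Summit.QuantumFields.BalabanUV.Beta.GAN24.RespStepBmDecompExact (respStepBmSeq)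
open Summit.QuantumFields.BalabanUV.Beta.GAN24.SrecWilsonSector (isFF_smul isFF_unitS e3K_coDressKBmAt_KStepUnit_of_isFF legDecay_respStepBmSeq)
open Summit.QuantumFields.BalabanUV.Beta.GAN24.SrecBornSector (unitStepMap isLoc_zero isLoc_add isLoc_smul unitS_finset_sum isFF_transport_push)
open Summit.QuantumFields.BalabanUV.Beta.SymCorrectorKernel (psiKS)
open Summit.QuantumFields.BalabanUV.Beta.SymCorrectorFace (slotPsiS)
open Summit.QuantumFields.BalabanUV.Beta.SymmetrisedStepJets (SymTables)
open Summit.QuantumFields.BalabanUV.Beta.CombChartStepJets (GcombSh decays_GcombSh ScombOf)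
open Summit.QuantumFields.BalabanUV.Beta.GAN24.SrecUnits (KStepUnit_eq)
open Summit.QuantumFields.BalabanUV.Beta.GAN24.CombCubicStepTransport (locStencil_transportPsiS)
open Summit.QuantumFields.BalabanUV.Beta.GAN24.CombTransportThreeLegs (isFF_transport)
open Summit.QuantumFields.BalabanUV.Beta.GAN24.CombTransportPush (push₃_transport_eq_push₃_legComp)
open Summit.QuantumFields.BalabanUV.Beta.GAN24.CombWilsonStepPush (unitS_transport unitS_combCubicStep_eq legDecay_legComp_psiKS)
open Summit.QuantumFields.BalabanUV.Beta.GAN24.CombWilsonSector (combWilsonAt combBornOf combBornOf_zero combBornOf_succ locStencil_combBornOf)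

namespace Summit.QuantumFields.BalabanUV.Beta.GAN24.CombBornSector

variable {d : ℕ} {Lc : ℕ} [NeZero Lc]

/-! ## §1 Sources and level maps -/

section Defs

/-- [our object — bookkeeping, asserting nothing] **THE SOURCES OF THE (III′) REMAINDER AT THE SYM TABLES**: member `0` = the border and Λ sectors of
`ScombOf … 0` (its Wilson summand removed: M.50 `combBornOf_zero`); member `j+1` = the FRESH border and Λ sectors that `RecursiveStencilSlot.SrecOf_succ` adds
at level `j+1` (leaf-03's (E) `SrecBornSector.freshAt ρ` with `(vhSAt ρ, hessFFAt ρ) ↦ (tabs.V, tabs.H)`). -/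
def combFreshAt (tabs : SymTables d Lc) (cVH cΛ : ℝ) : ℕ → Fin (d + 1) → (Fin (d + 1) → ℤ) → MKer (d + 1) (Fib d)
  | 0 => fun κ' u' => cVH • tabs.V κ' u' + cΛ • SLam Lc (lamCoeffOf (KInv (N := Lc) (d := d)) Lc) tabs.H κ' u'
  | j + 1 => fun κ' u' => (cVH * wVH d Lc (j + 1)) • tabs.V κ' u' +
      (cΛ * wΛ d Lc (j + 1)) • SLam Lc (lamCoeffK (KInvStep (d := d) Lc (j + 1)) (E2 d Lc (j + 1)) Lc) tabs.H κ' u'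

variable (Lc)

/-- [our object — bookkeeping, asserting nothing] **THE LEVEL MAP OF THE (III′) RECURSION** (native units): `combStepMap Lc cE j S = (cE·wE (j+1)) • e3OfK Lc G′_j S`,
`G′_j = GcombSh Lc j` (leaf-03's (E) `stepMap ρ` with the comb-chart resolvent in place of `coDressKBmAt ρ Lc (KInvStep Lc j)`). -/
def combStepMap (cE : ℝ) (j : ℕ) (S : Fin (d + 1) → (Fin (d + 1) → ℤ) → MKer (d + 1) (Fib d)) :
    Fin (d + 1) → (Fin (d + 1) → ℤ) → MKer (d + 1) (Fib d) :=
  fun κ' u' => (cE * wE d Lc (j + 1)) • e3OfK Lc (GcombSh (d := d) Lc j) S κ' u'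

/-- [our object — bookkeeping, asserting nothing] **THE LEVEL MAP IN THE ADOPTED UNITS**: `combUnitStepMap Lc cE j S = (cE·Lc^{2(d+1)}) • e3K (coDressKBmAt ρ_c Lc K̃_j) Lc (𝒯 S)`,
`𝒯 S κ u = Ψ̂ᵀ ∘ slotPsiS S κ u ∘ Ψ̂` — (E)'s `SrecBornSector.unitStepMap` at the root `ρ_c` READ ON THE TRANSPORTED TABLE (M.43 ∕ M.49: the (III′) cubic step in units). -/
def combUnitStepMap (cE : ℝ) (j : ℕ) (S : Fin (d + 1) → (Fin (d + 1) → ℤ) → MKer (d + 1) (Fib d)) :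
    Fin (d + 1) → (Fin (d + 1) → ℤ) → MKer (d + 1) (Fib d) :=
  fun κ' u' => (cE * (Lc : ℝ) ^ (2 * (d + 1))) •
    e3K (coDressKBmAt (ctr (d + 1) Lc) Lc (KStepUnit (d := d) Lc j)) Lc
      (fun κ u => comp (comp (trK (psiKS (ctrOff (d + 1) Lc) Lc)) (slotPsiS (ctrOff (d + 1) Lc) Lc S κ u)) (psiKS (ctrOff (d + 1) Lc) Lc)) κ' u'

/-- [folklore] **THE (III′) UNIT LEVEL MAP IS THE (E) ONE AT THE ROOT `ρ_c`, READ ON THE TRANSPORTED TABLE** (by `rfl`; `ctr (d+1) Lc = toSite (ctrOff (d+1) Lc)`). -/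
theorem combUnitStepMap_eq_unitStepMap_transport (cE : ℝ) (j : ℕ) (S : Fin (d + 1) → (Fin (d + 1) → ℤ) → MKer (d + 1) (Fib d)) :
    combUnitStepMap Lc cE j S = unitStepMap Lc (ctr (d + 1) Lc) cE j
      (fun κ u => comp (comp (trK (psiKS (ctrOff (d + 1) Lc) Lc)) (slotPsiS (ctrOff (d + 1) Lc) Lc S κ u)) (psiKS (ctrOff (d + 1) Lc) Lc)) := rfl

/-- [folklore] **EVERY NATIVE LEVEL MAP LANDS IN ff-VALUED TABLES**, whatever the table (`e3OfK … = −mmRead …`, `Push4.isFF_mmRead`). -/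
theorem isFF_combStepMap (cE : ℝ) (j : ℕ) (S : Fin (d + 1) → (Fin (d + 1) → ℤ) → MKer (d + 1) (Fib d)) (κ : Fin (d + 1)) (u : Fin (d + 1) → ℤ) :
    IsFF (combStepMap Lc cE j S κ u) := by
  refine isFF_smul ⟨fun x z μ b => ?_, fun x z a ν => ?_⟩ _
  · rw [e3OfK_apply, (isFF_mmRead _ _).1, neg_zero]
  · rw [e3OfK_apply, (isFF_mmRead _ _).2, neg_zero]

/-- [folklore] **EVERY UNIT LEVEL MAP LANDS IN ff-VALUED TABLES**, whatever the table (`e3K … = −mmRead …`). -/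
theorem isFF_combUnitStepMap (cE : ℝ) (j : ℕ) (S : Fin (d + 1) → (Fin (d + 1) → ℤ) → MKer (d + 1) (Fib d)) (κ : Fin (d + 1)) (u : Fin (d + 1) → ℤ) :
    IsFF (combUnitStepMap Lc cE j S κ u) := by
  refine isFF_smul ⟨fun x z μ b => ?_, fun x z a ν => ?_⟩ _
  · rw [← e3OfK_eq_e3K, e3OfK_apply, (isFF_mmRead _ _).1, neg_zero]
  · rw [← e3OfK_eq_e3K, e3OfK_apply, (isFF_mmRead _ _).2, neg_zero]

variable {Lc} (tabs : SymTables d Lc) (cE cVH cΛ : ℝ)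

/-- [folklore] Member `0` of the remainder is the source `combFreshAt 0` (M.50 `combBornOf_zero`). -/
theorem combBornOf_zero_eq_combFreshAt : combBornOf Lc tabs cE cVH cΛ 0 = combFreshAt tabs cVH cΛ 0 := by
  rw [combBornOf_zero]
  rfl

/-- [folklore] The decoupled recursion in `combStepMap` ∕ `combFreshAt` form (M.50 `combBornOf_succ`). -/
theorem combBornOf_succ_eq (j : ℕ) :
    combBornOf Lc tabs cE cVH cΛ (j + 1) = combStepMap Lc cE j (combBornOf Lc tabs cE cVH cΛ j) + combFreshAt tabs cVH cΛ (j + 1) := by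
  rw [combBornOf_succ]
  funext κ' u'
  simp only [combStepMap, combFreshAt, Pi.add_apply]
  abel

end Defs

/-! ## §2 The class of local stencil families -/

/-- [folklore] **THE LEVEL MAP PRESERVES THE CLASS** (an2's `locStencil_e3OfK` with `CombChartStepJets.decays_GcombSh`). -/
theorem isLoc_combStepMap (cE : ℝ) (j : ℕ) {S : Fin (d + 1) → (Fin (d + 1) → ℤ) → MKer (d + 1) (Fib d)} (hS : ∃ Cs δ : ℝ, 0 < δ ∧ LocStencil S Cs δ) :
    ∃ Cs δ : ℝ, 0 < δ ∧ LocStencil (combStepMap Lc cE j S) Cs δ := by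
  obtain ⟨C, δ, hδ, h⟩ := hS
  obtain ⟨C₁, δ₁, hδ₁, h1⟩ := locStencil_e3OfK (N := Lc) (one_le_of_neZero Lc) (decays_GcombSh (d := d) Lc j) h hδ
  exact ⟨_, δ₁, hδ₁, locStencil_smul _ h1⟩

/-- [folklore] **THE LEVEL MAP IS ADDITIVE ON THE CLASS** (leaf-01's `SrecLinearPartEq.e3K_add`: the cubic functional of a decaying kernel is additive on local families;
M.50 `combBornOf_succ` used the same split). -/
theorem combStepMap_add (cE : ℝ) (j : ℕ) {S S' : Fin (d + 1) → (Fin (d + 1) → ℤ) → MKer (d + 1) (Fib d)} (hS : ∃ Cs δ : ℝ, 0 < δ ∧ LocStencil S Cs δ)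
    (hS' : ∃ Cs δ : ℝ, 0 < δ ∧ LocStencil S' Cs δ) :
    combStepMap Lc cE j (S + S') = combStepMap Lc cE j S + combStepMap Lc cE j S' := by
  obtain ⟨C, δ, hδ, h⟩ := hS
  obtain ⟨C', δ', hδ', h'⟩ := hS'
  obtain ⟨δG, CG, hδG, -, hG⟩ := decays_GcombSh (d := d) Lc j
  funext κ' u'
  simp only [combStepMap, Pi.add_apply]
  rw [e3OfK_eq_e3K, e3OfK_eq_e3K, e3OfK_eq_e3K, ← smul_add, ← e3K_add hG hδG Lc h h' hδ hδ' κ' u']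
  rfl

/-- [folklore] The remainder, hence every source, is in the class (M.50 `locStencil_combBornOf`; `combFreshAt (j+1) = combBornOf (j+1) − combStepMap j (combBornOf j)`). -/
theorem isLoc_combFreshAt (tabs : SymTables d Lc) (cE cVH cΛ : ℝ) : ∀ j, ∃ Cs δ : ℝ, 0 < δ ∧ LocStencil (combFreshAt tabs cVH cΛ j) Cs δ
  | 0 => by rw [← combBornOf_zero_eq_combFreshAt tabs cE]; exact locStencil_combBornOf tabs cE cVH cΛ 0
  | j + 1 => by
    have e : combFreshAt tabs cVH cΛ (j + 1)
        = combBornOf Lc tabs cE cVH cΛ (j + 1) + fun κ u => (-1 : ℝ) • combStepMap Lc cE j (combBornOf Lc tabs cE cVH cΛ j) κ u := by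
      rw [combBornOf_succ_eq]; funext κ u; simp only [Pi.add_apply, neg_one_smul]; abel
    rw [e]
    exact isLoc_add (locStencil_combBornOf tabs cE cVH cΛ (j + 1)) (isLoc_smul (isLoc_combStepMap cE j (locStencil_combBornOf tabs cE cVH cΛ j)) _)

omit [NeZero Lc] in
/-- [folklore] The class is preserved by the change of units (`HessKerDressedUnits.locStencil_unitS`, same rate). -/
theorem isLoc_unitS (sf sm : ℝ) {S : Fin (d + 1) → (Fin (d + 1) → ℤ) → MKer (d + 1) (Fib d)} (hS : ∃ Cs δ : ℝ, 0 < δ ∧ LocStencil S Cs δ) :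
    ∃ Cs δ : ℝ, 0 < δ ∧ LocStencil (unitS sf sm S) Cs δ := by
  obtain ⟨C, δ, hδ, h⟩ := hS
  exact ⟨_, δ, hδ, locStencil_unitS h⟩

omit [NeZero Lc] in
/-- [folklore] **THE CLASS IS PRESERVED BY A THREE-LEG PUSH THROUGH LOCALISED LEGS** (one leg family in all three slots; leaf-01's `Push3.locStencil_push₃_mono` after
shrinking the table's rate below half the legs' rate). -/
theorem isLoc_push₃ {N : ℕ} (hN : 1 ≤ N) {l : LegFam d} (hl : ∃ C m : ℝ, 0 < m ∧ LegDecay l N C m)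
    {S : Fin (d + 1) → (Fin (d + 1) → ℤ) → MKer (d + 1) (Fib d)} (hS : ∃ Cs δ : ℝ, 0 < δ ∧ LocStencil S Cs δ) :
    ∃ Cs δ : ℝ, 0 < δ ∧ LocStencil (push₃ l l l S) Cs δ := by
  obtain ⟨Cl, m, hm, hl⟩ := hl
  obtain ⟨C, δ, hδ, h⟩ := hS
  have hC : 0 ≤ C := (h 0 0).nonneg (Sum.inl 0)
  have hδ' : 0 < min δ (m / 4) := lt_min hδ (by positivity)
  have h' := locStencil_mono h hC (min_le_left δ (m / 4))
  have hm' : 2 * min δ (m / 4) < m := by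
    have := min_le_right δ (m / 4); linarith
  exact ⟨_, _, hδ', locStencil_push₃_mono hN hl hl hl h' hδ'.le hm'⟩

/-! ## §3 The unrolled remainder (leaf-01's discrete Duhamel engine) -/

/-- NOT IN PRINT; OUR BOOKKEEPING ([folklore]; the (III′) twin of leaf-03's `SrecBornSector.bornSecAt_eq_sum_transport`).  **THE (III′) REMAINDER UNROLLED**:
`combBornOf k = transport combStepMap 0 k (combFreshAt 0) + Σ_{m<k} transport combStepMap (m+1) (k−1−m) (combFreshAt (m+1))` — every level-`i` sym-table source
transported through the comb level maps `i, …, k−1` (`AffineUnroll.eq_transport_add_sum` on the class of local families). -/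
theorem combBornOf_eq_sum_transport (tabs : SymTables d Lc) (cE cVH cΛ : ℝ) (k : ℕ) :
    combBornOf Lc tabs cE cVH cΛ k
      = transport (combStepMap Lc cE) 0 k (combFreshAt tabs cVH cΛ 0)
        + ∑ m ∈ Finset.range k, transport (combStepMap Lc cE) (m + 1) (k - 1 - m) (combFreshAt tabs cVH cΛ (m + 1)) := by
  have h := eq_transport_add_sum (A := combStepMap Lc cE)
    (P := fun S => ∃ Cs δ : ℝ, 0 < δ ∧ LocStencil S Cs δ) isLoc_zero (fun _ _ hx hy => isLoc_add hx hy)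
    (fun j _ hx => isLoc_combStepMap cE j hx) (fun j _ _ hx hy => combStepMap_add cE j hx hy)
    (x := combBornOf Lc tabs cE cVH cΛ) (b := fun j => combFreshAt tabs cVH cΛ (j + 1))
    (by rw [combBornOf_zero_eq_combFreshAt]; exact isLoc_combFreshAt tabs cE cVH cΛ 0) (fun j => isLoc_combFreshAt tabs cE cVH cΛ (j + 1))
    (fun j => combBornOf_succ_eq tabs cE cVH cΛ j) k
  rw [combBornOf_zero_eq_combFreshAt] at h
  exact h

/-! ## §4 Units, on the class -/

/-- NOT IN PRINT; OUR BOOKKEEPING ([folklore]).  **THE LEVEL MAP IN UNITS, ON LOCAL TABLES**: `unitS_{j+1} (combStepMap j S) = combUnitStepMap j (unitS_j S)` whenever `S` is a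
localised stencil family (M.49 `CombWilsonStepPush.unitS_combCubicStep_eq` — the OWNER's `SrecUnits.unitS_cubicPiece_eq` + asym1's `unitK_coDressKBmAt` behind M.43's
transport identity — then M.49 `unitS_transport`: the units pass through `𝒯`).  At (E) (`SrecBornSector.unitS_stepMap`) no hypothesis was needed; here the
localisation feeds M.43's `e3OfK_GcombSh_eq_bm_transport`. -/
theorem unitS_combStepMap (cE : ℝ) (j : ℕ) {S : Fin (d + 1) → (Fin (d + 1) → ℤ) → MKer (d + 1) (Fib d)} (hS : ∃ Cs δ : ℝ, 0 < δ ∧ LocStencil S Cs δ) :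
    unitS (sfStep Lc (j + 1)) (smStep d Lc (j + 1)) (combStepMap Lc cE j S)
      = combUnitStepMap Lc cE j (unitS (sfStep Lc j) (smStep d Lc j) S) := by
  obtain ⟨C, δ, hδ, h⟩ := hS
  show unitS (sfStep Lc (j + 1)) (smStep d Lc (j + 1)) (fun κ' u' => (cE * wE d Lc (j + 1)) • e3OfK Lc (GcombSh (d := d) Lc j) S κ' u') = _
  rw [unitS_combCubicStep_eq cE j h hδ, unitS_transport]
  rfl

/-- NOT IN PRINT; OUR BOOKKEEPING ([folklore]).  **UNITS COMMUTE WITH THE TRANSPORT, ON THE CLASS**: for a localised `S` and every `n`,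
`unitS_{m+n} (transport combStepMap m n S) = transport combUnitStepMap m n (unitS_m S)` (induction on `n`; the running table stays in the class by `isLoc_combStepMap`). -/
theorem unitS_transport_combStepMap (cE : ℝ) (m : ℕ) {S : Fin (d + 1) → (Fin (d + 1) → ℤ) → MKer (d + 1) (Fib d)}
    (hS : ∃ Cs δ : ℝ, 0 < δ ∧ LocStencil S Cs δ) :
    ∀ n, unitS (sfStep Lc (m + n)) (smStep d Lc (m + n)) (transport (combStepMap Lc cE) m n S)
      = transport (combUnitStepMap Lc cE) m n (unitS (sfStep Lc m) (smStep d Lc m) S)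
  | 0 => by simp only [Nat.add_zero, transport_zero]
  | n + 1 => by
    rw [transport_succ, transport_succ, ← unitS_transport_combStepMap cE m hS n, show m + (n + 1) = m + n + 1 from rfl,
      unitS_combStepMap cE (m + n) (transport_mem (P := fun S => ∃ Cs δ : ℝ, 0 < δ ∧ LocStencil S Cs δ) (fun j _ hx => isLoc_combStepMap cE j hx) m n hS)]

/-- [folklore] The same with the total level named (`m + n = t`). -/
theorem unitS_transport_combStepMap' (cE : ℝ) {m n t : ℕ} (ht : m + n = t) {S : Fin (d + 1) → (Fin (d + 1) → ℤ) → MKer (d + 1) (Fib d)}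
    (hS : ∃ Cs δ : ℝ, 0 < δ ∧ LocStencil S Cs δ) :
    unitS (sfStep Lc t) (smStep d Lc t) (transport (combStepMap Lc cE) m n S)
      = transport (combUnitStepMap Lc cE) m n (unitS (sfStep Lc m) (smStep d Lc m) S) := by
  subst ht; exact unitS_transport_combStepMap cE m hS n

/-! ## §5 The unit transport of an ff-valued local table is ONE three-leg push through the CONJUGATED dressed leg chain -/

/-- NOT IN PRINT; OUR BOOKKEEPING ([folklore]).  **ON AN ff-VALUED LOCAL TABLE THE UNIT LEVEL MAP IS ONE PUSH THROUGH THE CONJUGATED LEGS `ψ♭ ∘ R_j`**: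
`combUnitStepMap j X = c₃ • push₃ (legComp ψ♭ R_j) (legComp ψ♭ R_j) (legComp ψ♭ R_j) X` (`𝒯 X` is ff-valued: M.46 `isFF_transport`; leaf-03's
`e3K_coDressKBmAt_KStepUnit_of_isFF` gives the push through `R_j` of `𝒯 X`; M.47 `push₃_transport_eq_push₃_legComp` absorbs `𝒯` into the legs).  At (E) the same display
with `R_j` in place of `legComp ψ♭ R_j` is `SrecBornSector.unitStepMap_of_isFF` (no locality needed there). -/
theorem combUnitStepMap_of_isFF (cE : ℝ) (j : ℕ) {X : Fin (d + 1) → (Fin (d + 1) → ℤ) → MKer (d + 1) (Fib d)} (hff : ∀ κ u, IsFF (X κ u))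
    (hXl : ∃ Cs δ : ℝ, 0 < δ ∧ LocStencil X Cs δ) :
    combUnitStepMap Lc cE j X = fun κ' u' => (cE * (Lc : ℝ) ^ (2 * (d + 1))) •
      push₃ (legComp (fun α x κ u => psiKS (ctrOff (d + 1) Lc) Lc u x (Sum.inl κ) (Sum.inl α)) (respStepBmSeq (ctr (d + 1) Lc) Lc j))
        (legComp (fun α x κ u => psiKS (ctrOff (d + 1) Lc) Lc u x (Sum.inl κ) (Sum.inl α)) (respStepBmSeq (ctr (d + 1) Lc) Lc j))
        (legComp (fun α x κ u => psiKS (ctrOff (d + 1) Lc) Lc u x (Sum.inl κ) (Sum.inl α)) (respStepBmSeq (ctr (d + 1) Lc) Lc j)) X κ' u' := by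
  have hLc : 0 < Lc := Nat.pos_of_ne_zero (NeZero.ne Lc)
  have hr : ctrOff (d + 1) Lc ∈ box (d + 1) Lc := ctrOff_mem_box hLc
  obtain ⟨C, δ, hδ, hX⟩ := hXl
  obtain ⟨CR, mR, hmR, hR'⟩ := legDecay_respStepBmSeq (Lc := Lc) hr j
  have hR : LegDecay (respStepBmSeq (ctr (d + 1) Lc) Lc j) Lc CR mR := hR'
  funext κ' u'
  show (cE * (Lc : ℝ) ^ (2 * (d + 1))) • e3K (coDressKBmAt (ctr (d + 1) Lc) Lc (KStepUnit (d := d) Lc j)) Lc _ κ' u' = _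
  rw [e3K_coDressKBmAt_KStepUnit_of_isFF (ctr (d + 1) Lc) j (fun κ u => isFF_transport hLc hr hff κ u) κ' u',
    push₃_transport_eq_push₃_legComp hLc hr hR hR hR hmR hff hX hδ κ' u']

/-- [folklore] **THE CONJUGATED DRESSED LEGS AT THE COMB CHART ARE LOCALISED** (M.49 `legDecay_legComp_psiKS` with leaf-03's `legDecay_respStepBmSeq` at the root `ρ_c`). -/
theorem legDecay_combLeg (j : ℕ) : ∃ C m : ℝ, 0 < m ∧
    LegDecay (legComp (fun α x κ u => psiKS (ctrOff (d + 1) Lc) Lc u x (Sum.inl κ) (Sum.inl α)) (respStepBmSeq (ctr (d + 1) Lc) Lc j)) Lc C m := by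
  have hLc : 0 < Lc := Nat.pos_of_ne_zero (NeZero.ne Lc)
  have hr : ctrOff (d + 1) Lc ∈ box (d + 1) Lc := ctrOff_mem_box hLc
  exact legDecay_legComp_psiKS hLc hr (R := respStepBmSeq (ctr (d + 1) Lc) Lc j) (legDecay_respStepBmSeq (Lc := Lc) hr j)

/-- [folklore] The transport of pushes through the conjugated legs keeps the class (`isLoc_push₃`, `legDecay_combLeg`). -/
theorem isLoc_transport_push (m : ℕ) {S : Fin (d + 1) → (Fin (d + 1) → ℤ) → MKer (d + 1) (Fib d)} (hS : ∃ Cs δ : ℝ, 0 < δ ∧ LocStencil S Cs δ) (n : ℕ) :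
    ∃ Cs δ : ℝ, 0 < δ ∧ LocStencil (transport (fun j T => push₃
      (legComp (fun α x κ u => psiKS (ctrOff (d + 1) Lc) Lc u x (Sum.inl κ) (Sum.inl α)) (respStepBmSeq (ctr (d + 1) Lc) Lc j))
      (legComp (fun α x κ u => psiKS (ctrOff (d + 1) Lc) Lc u x (Sum.inl κ) (Sum.inl α)) (respStepBmSeq (ctr (d + 1) Lc) Lc j))
      (legComp (fun α x κ u => psiKS (ctrOff (d + 1) Lc) Lc u x (Sum.inl κ) (Sum.inl α)) (respStepBmSeq (ctr (d + 1) Lc) Lc j)) T) m n S) Cs δ :=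
  transport_mem (P := fun S => ∃ Cs δ : ℝ, 0 < δ ∧ LocStencil S Cs δ) (fun j _ hx => isLoc_push₃ (one_le_of_neZero Lc) (legDecay_combLeg (Lc := Lc) j) hx) m n hS

/-- [folklore] **THE UNIT TRANSPORT OF AN ff-VALUED LOCAL TABLE IS THE SCALED TRANSPORT OF PUSHES THROUGH THE CONJUGATED LEGS** (induction; `push₃_smul`; the running table
stays ff-valued — (E)'s `isFF_transport_push` BY NAME — and in the class — `isLoc_transport_push`). -/
theorem transport_combUnitStepMap_succ_eq_transport (cE : ℝ) (m : ℕ) {S : Fin (d + 1) → (Fin (d + 1) → ℤ) → MKer (d + 1) (Fib d)}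
    (hff : ∀ κ u, IsFF (S κ u)) (hS : ∃ Cs δ : ℝ, 0 < δ ∧ LocStencil S Cs δ) :
    ∀ n, transport (combUnitStepMap Lc cE) m (n + 1) S = fun κ' u' => (cE * (Lc : ℝ) ^ (2 * (d + 1))) ^ (n + 1) •
      transport (fun j T => push₃
        (legComp (fun α x κ u => psiKS (ctrOff (d + 1) Lc) Lc u x (Sum.inl κ) (Sum.inl α)) (respStepBmSeq (ctr (d + 1) Lc) Lc j))
        (legComp (fun α x κ u => psiKS (ctrOff (d + 1) Lc) Lc u x (Sum.inl κ) (Sum.inl α)) (respStepBmSeq (ctr (d + 1) Lc) Lc j))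
        (legComp (fun α x κ u => psiKS (ctrOff (d + 1) Lc) Lc u x (Sum.inl κ) (Sum.inl α)) (respStepBmSeq (ctr (d + 1) Lc) Lc j)) T) m (n + 1) S κ' u'
  | 0 => by
    rw [transport_succ, transport_zero, combUnitStepMap_of_isFF cE (m + 0) hff hS]
    funext κ' u'
    simp only [transport_succ, transport_zero, zero_add, pow_one]
  | n + 1 => by
    rw [transport_succ, transport_combUnitStepMap_succ_eq_transport cE m hff hS n,
      combUnitStepMap_of_isFF cE (m + (n + 1)) (fun κ u => isFF_smul (isFF_transport_push _ m hff (n + 1) κ u) _)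
        (isLoc_smul (isLoc_transport_push (Lc := Lc) m hS (n + 1)) _)]
    funext κ' u'
    show (cE * (Lc : ℝ) ^ (2 * (d + 1))) • push₃ _ _ _ (fun κ u => (cE * (Lc : ℝ) ^ (2 * (d + 1))) ^ (n + 1) • transport _ m (n + 1) S κ u) κ' u' = _
    rw [push₃_smul, smul_smul]
    simp only [transport_succ]
    congr 1
    ring

/-- NOT IN PRINT; OUR BOOKKEEPING ([folklore]).  **THE UNIT TRANSPORT OF AN ff-VALUED LOCAL TABLE THROUGH `n+1` LEVELS FROM BASE `m` IS ONE THREE-LEG PUSH THROUGH THE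
CONJUGATED DRESSED LEG CHAIN**: `transport combUnitStepMap m (n+1) X = fun κ′ u′ ↦ c₃^{n+1} • push₃ T′ T′ T′ X κ′ u′`, `T′ = legChain (fun j ↦ legComp ψ♭ R_j) m n`
(leaf-01's `Push3Nest.transport_push₃`; the legs are localised by `legDecay_combLeg`).  Leaf-03's (E) `SrecBornSector.transport_unitStepMap_succ_eq_push₃` is the same display
with `T = legChain R m n`: **the (III′) born sectors' later legs differ from the (E) ones EXACTLY by `R_j ↦ legComp ψ♭ R_j`.** -/
theorem transport_combUnitStepMap_succ_eq_push₃ (cE : ℝ) (m : ℕ) {S : Fin (d + 1) → (Fin (d + 1) → ℤ) → MKer (d + 1) (Fib d)}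
    (hff : ∀ κ u, IsFF (S κ u)) (hS : ∃ Cs δ : ℝ, 0 < δ ∧ LocStencil S Cs δ) (n : ℕ) :
    transport (combUnitStepMap Lc cE) m (n + 1) S = fun κ' u' => (cE * (Lc : ℝ) ^ (2 * (d + 1))) ^ (n + 1) •
      push₃
        (legChain (fun j => legComp (fun α x κ u => psiKS (ctrOff (d + 1) Lc) Lc u x (Sum.inl κ) (Sum.inl α)) (respStepBmSeq (ctr (d + 1) Lc) Lc j)) m n)
        (legChain (fun j => legComp (fun α x κ u => psiKS (ctrOff (d + 1) Lc) Lc u x (Sum.inl κ) (Sum.inl α)) (respStepBmSeq (ctr (d + 1) Lc) Lc j)) m n)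
        (legChain (fun j => legComp (fun α x κ u => psiKS (ctrOff (d + 1) Lc) Lc u x (Sum.inl κ) (Sum.inl α)) (respStepBmSeq (ctr (d + 1) Lc) Lc j)) m n)
        S κ' u' := by
  have hT := fun j => legDecay_combLeg (d := d) (Lc := Lc) j
  rw [transport_combUnitStepMap_succ_eq_transport cE m hff hS n, transport_push₃ (one_le_of_neZero Lc) hT hT hT hS m n]

/-- NOT IN PRINT; OUR BOOKKEEPING ([folklore]).  **FROM THE SECOND LEVEL ON, EVERY SOURCE RIDES THE CONJUGATED LEG CHAIN**: for ANY source `S` in the class (ff-valued or not),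
`transport combUnitStepMap i (n+2) S = fun κ′ u′ ↦ c₃^{n+1} • push₃ T″ T″ T″ (combUnitStepMap i S) κ′ u′`, `T″ = legChain (fun j ↦ legComp ψ♭ R_j) (i+1) n` — the FIRST unit
level map already lands in ff-valued local tables (`isFF_combUnitStepMap`; class: `unitS ∘ combStepMap ∘ unitS⁻¹` is not needed — `combUnitStepMap i S = unitStepMap ρ_c i (𝒯 S)`
is `c₃ • e3K …`, localised by an2's `locStencil_e3OfK`), so §5 applies from level `i+1`.  Its first step on a NON-ff source is (E)'s four-channel word READ ON `𝒯 S`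
(leaf-01 g43's `RespStepBm.e3K_coDressKBmAt_KStepUnit`, multiplier legs undressed) — by `combUnitStepMap_eq_unitStepMap_transport`. -/
theorem transport_combUnitStepMap_succ_succ_eq_push₃ (cE : ℝ) (i : ℕ) {S : Fin (d + 1) → (Fin (d + 1) → ℤ) → MKer (d + 1) (Fib d)}
    (hS : ∃ Cs δ : ℝ, 0 < δ ∧ LocStencil S Cs δ) (n : ℕ) :
    transport (combUnitStepMap Lc cE) i (n + 2) S = fun κ' u' => (cE * (Lc : ℝ) ^ (2 * (d + 1))) ^ (n + 1) •
      push₃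
        (legChain (fun j => legComp (fun α x κ u => psiKS (ctrOff (d + 1) Lc) Lc u x (Sum.inl κ) (Sum.inl α)) (respStepBmSeq (ctr (d + 1) Lc) Lc j)) (i + 1) n)
        (legChain (fun j => legComp (fun α x κ u => psiKS (ctrOff (d + 1) Lc) Lc u x (Sum.inl κ) (Sum.inl α)) (respStepBmSeq (ctr (d + 1) Lc) Lc j)) (i + 1) n)
        (legChain (fun j => legComp (fun α x κ u => psiKS (ctrOff (d + 1) Lc) Lc u x (Sum.inl κ) (Sum.inl α)) (respStepBmSeq (ctr (d + 1) Lc) Lc j)) (i + 1) n)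
        (combUnitStepMap Lc cE i S) κ' u' := by
  have hLc : 0 < Lc := Nat.pos_of_ne_zero (NeZero.ne Lc)
  have hr : ctrOff (d + 1) Lc ∈ box (d + 1) Lc := ctrOff_mem_box hLc
  -- the first image is ff-valued and localised
  have hff : ∀ κ u, IsFF (combUnitStepMap Lc cE i S κ u) := isFF_combUnitStepMap Lc cE i S
  have hloc : ∃ Cs δ : ℝ, 0 < δ ∧ LocStencil (combUnitStepMap Lc cE i S) Cs δ := by
    obtain ⟨C, δ, hδ, h⟩ := hS
    -- `𝒯 S` is localised (M.43 `locStencil_transportPsiS`), then an2's `locStencil_e3OfK` with the co-dressed unit kernel's decay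
    obtain ⟨C₁, δ₁, hδ₁, h₁⟩ := locStencil_transportPsiS hLc hr h hδ
    -- the co-dressed unit step resolvent decays (lit `decays_KInvStep`, `decays_unitK`, `decays_coDressKBmAt`)
    obtain ⟨δK, CK, hδK, -, hK⟩ := decays_KInvStep (d := d) (Lc := Lc) i
    have hKu : Decays (KStepUnit (d := d) Lc i) (max |sfStep Lc i| |smStep d Lc i| * CK * max |sfStep Lc i| |smStep d Lc i|) δK := by
      rw [KStepUnit_eq]; exact decays_unitK hK
    have hG : ∃ δ C : ℝ, 0 < δ ∧ 0 ≤ C ∧ Decays (coDressKBmAt (ctr (d + 1) Lc) Lc (KStepUnit (d := d) Lc i)) C δ :=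
      decays_coDressKBmAt (one_le_of_neZero Lc) hr ⟨δK, _, hδK, hKu.nonneg (Sum.inl 0), hKu⟩
    obtain ⟨C₂, δ₂, hδ₂, h₂⟩ := locStencil_e3OfK (N := Lc) (one_le_of_neZero Lc) hG h₁ hδ₁
    have e : combUnitStepMap Lc cE i S = fun κ' u' => (cE * (Lc : ℝ) ^ (2 * (d + 1))) •
        e3OfK Lc (coDressKBmAt (ctr (d + 1) Lc) Lc (KStepUnit (d := d) Lc i))
          (fun κ u => comp (comp (trK (psiKS (ctrOff (d + 1) Lc) Lc)) (slotPsiS (ctrOff (d + 1) Lc) Lc S κ u)) (psiKS (ctrOff (d + 1) Lc) Lc)) κ' u' := by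
      funext κ' u'
      show _ = (cE * (Lc : ℝ) ^ (2 * (d + 1))) • e3OfK Lc _ _ κ' u'
      rw [e3OfK_eq_e3K]
      rfl
    rw [e]
    exact ⟨_, δ₂, hδ₂, locStencil_smul _ h₂⟩
  rw [show n + 2 = (n + 1) + 1 from rfl, transport_succ' , transport_combUnitStepMap_succ_eq_push₃ cE (i + 1) hff hloc n]

/-! ## §6 The closed form in units -/

/-- NOT IN PRINT; OUR BOOKKEEPING ([folklore]; the (III′) twin of leaf-03's (E-α-V) `SrecBornSector.unitS_bornSecAt_eq_sum`).
**THE (III′) BORN REMAINDER OF THE COMB-CHART S-TOWER, MEMBER `k`, IN THE ADOPTED UNITS — CLOSED FORM**: for every `k`,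
`unitS_k (combBornOf k) = transport combUnitStepMap 0 k (unitS_0 (combFreshAt 0)) + Σ_{m<k} transport combUnitStepMap (m+1) (k−1−m) (unitS_{m+1} (combFreshAt (m+1)))`
— every level-`i` sym-table source, rescaled AT ITS OWN LEVEL, transported by the UNIT level maps `S ↦ c₃ • e3K (coDressKBmAt ρ_c Lc K̃_j) Lc (𝒯 S)`, `j = i … k−1`.
By §5 each transport with `≥ 2` steps is `c₃^{·} •` ONE three-leg push of the (ff-valued, local) first-step image `combUnitStepMap i (unitS_i (combFreshAt i))` through
`legChain (fun j ↦ legComp ψ♭ R_j) (i+1) ·` (`transport_combUnitStepMap_succ_succ_eq_push₃`); the first step is (E)'s unit level map at `ρ_c` read on `𝒯` of the source. -/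
theorem unitS_combBornOf_eq_sum (tabs : SymTables d Lc) (cE cVH cΛ : ℝ) (k : ℕ) :
    unitS (sfStep Lc k) (smStep d Lc k) (combBornOf Lc tabs cE cVH cΛ k)
      = transport (combUnitStepMap Lc cE) 0 k (unitS (sfStep Lc 0) (smStep d Lc 0) (combFreshAt tabs cVH cΛ 0))
        + ∑ m ∈ Finset.range k, transport (combUnitStepMap Lc cE) (m + 1) (k - 1 - m)
            (unitS (sfStep Lc (m + 1)) (smStep d Lc (m + 1)) (combFreshAt tabs cVH cΛ (m + 1))) := by
  rw [combBornOf_eq_sum_transport tabs cE cVH cΛ k]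
  have e : (transport (combStepMap Lc cE) 0 k (combFreshAt tabs cVH cΛ 0)
        + ∑ m ∈ Finset.range k, transport (combStepMap Lc cE) (m + 1) (k - 1 - m) (combFreshAt tabs cVH cΛ (m + 1)))
      = fun κ u => transport (combStepMap Lc cE) 0 k (combFreshAt tabs cVH cΛ 0) κ u
        + (∑ m ∈ Finset.range k, transport (combStepMap Lc cE) (m + 1) (k - 1 - m) (combFreshAt tabs cVH cΛ (m + 1))) κ u := by
    funext κ u; rfl
  rw [e, unitS_add, unitS_finset_sum, unitS_transport_combStepMap' cE (Nat.zero_add k) (isLoc_combFreshAt tabs cE cVH cΛ 0)]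
  funext κ u
  simp only [Pi.add_apply, Finset.sum_apply]
  congr 1
  refine Finset.sum_congr rfl fun m hm => ?_
  have hmk : m + 1 + (k - 1 - m) = k := by have := Finset.mem_range.1 hm; omega
  rw [unitS_transport_combStepMap' cE hmk (isLoc_combFreshAt tabs cE cVH cΛ (m + 1))]

end Summit.QuantumFields.BalabanUV.Beta.GAN24.CombBornSector

end
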